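import Summits.AtomisticToContinuum.HydrodynamicLimit.Theorems.AntiMazurCoboundariesCorrectorPressureDecayKiferCanonicalLocalLimit
import Summits.AtomisticToContinuum.HydrodynamicLimit.Theorems.AntiMazurCoboundariesCorrectorPressureDecayKiferEntropyLsc
import Literature.MathematicalPhysics.KineticTheory.HardSphereGibbsGNZSandwich
import Mathlib.InformationTheory.KullbackLeibler.Basic

/-!
# The Gibbs reference swap for window entropies (line `FirstLemma`, crux stmt-AtomisticToContinuum-14135)

Helper file of the registered stubs `c9_windowLaw_gibbs_ge_free` and `c9_klDiv_windowLaw_gibbs_le_klDiv_free_add`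
(lead seat c9, Gibbs route of the tangent entropy bound `stub_tangentEntropyBoundUniformGibbs`), namespace
`Summit.AtomisticToContinuum.HydrodynamicLimit.Theorems.KiferCompactification`.

For a DLR Gibbs state `G` of the unit-diameter hard-sphere gas (`IsHardSphereGibbs 1 z β u G`, activity `z ≥ 0`,
`β > 0`) and a bounded measurable window `Λ` with collar `T = (thickening 1 Λ) \ Λ`:

* `c9_windowLaw_gibbs_ge_free` — **the window law dominates the free finite-volume law up to the void cost of the
  collar**: `e^{-z vol T} · γ_Λ(A | ∅) ≤ G_Λ(A)` for every measurable `A`, where `γ_Λ(· | ∅)` is the specification with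
  EMPTY boundary condition as a measure (`gibbsSpecMeasure 1 z β u Λ ∅`) and `G_Λ = windowLaw Λ G`. Proof: the DLR
  equation in `Λ` on the window event `{ω | ω_Λ ∈ A}`, restricted to boundary conditions with no particle above the
  collar — for those the hard core does not reach into `Λ` and the specification of a window event IS the free one
  (`gibbsSpec_window_eq_free_of_void`) —, and the DLR equation in `T`, whose `k = 0` term gives the void bound
  `G{no particle above T} ≥ e^{-z vol T}` (`ofReal_exp_neg_le_measure_void`, from `1 ≤ weight(void)` and
  `weight(univ) ≤ e^{z vol T}`, `gibbsWeight_univ_le_ofReal_exp`).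
* `klDiv_le_klDiv_add_ofReal_log_of_le_smul` — the abstract **reference swap** for Mathlib's `InformationTheory.klDiv`:
  for probability measures with `R ≤ c • ν`, `KL(P ‖ ν) ≤ KL(P ‖ R) + log c` (Gibbs inequality for `(P, R)` and the
  Donsker–Varadhan upper bound for `(P, ν)`, both from `Literature.Probability.Divergences`).
* `c9_klDiv_windowLaw_gibbs_le_klDiv_free_add` — hence `KL(P ‖ G_Λ) ≤ KL(P ‖ γ_Λ(· | ∅)) + z · vol T` for every
  probability law `P`.

References: H.-O. Georgii, *Gibbs Measures and Phase Transitions* (2nd ed. 2011), §15.5 (comparison of finite-volume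
relative entropies under a change of boundary condition); D. Ruelle, *Statistical Mechanics* (1969), §3.4.
-/

noncomputable section

open MeasureTheory ProbabilityTheory Set Filter Topology InformationTheory
open scoped ENNReal NNReal

namespace Summit.AtomisticToContinuum.HydrodynamicLimit.Theorems.KiferCompactification

open Literature.MathematicalPhysics.KineticTheory (V3)
open Literature.MathematicalPhysics.KineticTheory.HardSphereDLR (gibbsSpecMeasure gibbsSpecMeasure_apply
  mem_superposeIn_iff hardCoreIn_anti gibbsWeight_univ_eq_tsum maxwellPhaseMeasure_univ sigmaFinite_maxwellPhaseMeasure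
  isProbabilityMeasure_gibbsSpecMeasure)
open Literature.MathematicalPhysics.KineticTheory.PointProcess (windowLaw windowRestrict measurable_windowRestrict
  isProbabilityMeasure_windowLaw)
open Literature.Analysis.FluidPDE (IsHardSphereGibbs HardCoreIn superposeIn gibbsWeight gibbsSpec maxwellPhaseMeasure)
open Literature.Analysis.FunctionSpaces (PointConfig)
open Literature.MathematicalPhysics.StatisticalMechanics (superposeIn_zero hardCoreIn_superposeIn_zero)

/-! ## The abstract reference swap for the Kullback–Leibler divergence -/

/-- **Reference swap for the relative entropy.** If the probability measures `ρ, ν` satisfy `ρ ≤ c • ν`, then for every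
probability measure `P`: `KL(P ‖ ν) ≤ KL(P ‖ ρ) + log c` (necessarily `c ≥ 1`). Proof without Radon–Nikodym
bookkeeping: for a bounded measurable test function `ψ`, `∫ e^ψ dρ ≤ c ∫ e^ψ dν`, so the Gibbs inequality
`∫ ψ dP ≤ KL(P ‖ ρ) + log ∫ e^ψ dρ` gives `∫ ψ dP ≤ KL(P ‖ ρ) + log c + log ∫ e^ψ dν`, and the Donsker–Varadhan upper
bound concludes. (The measure is called `ρ`, not `R`: `∂R` is a global Mathlib notation.) -/
theorem klDiv_le_klDiv_add_ofReal_log_of_le_smul {Ω : Type*} [MeasurableSpace Ω] (P ρ ν : Measure Ω)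
    [IsProbabilityMeasure P] [IsProbabilityMeasure ρ] [IsProbabilityMeasure ν] {c : ℝ}
    (h : ρ ≤ ENNReal.ofReal c • ν) : klDiv P ν ≤ klDiv P ρ + ENNReal.ofReal (Real.log c) := by
  have hc : 1 ≤ c := by
    have h1 : (1 : ℝ≥0∞) ≤ ENNReal.ofReal c := by
      calc (1 : ℝ≥0∞) = ρ univ := measure_univ.symm
        _ ≤ (ENNReal.ofReal c • ν) univ := Measure.le_iff'.1 h univ
        _ = ENNReal.ofReal c := by rw [Measure.smul_apply, smul_eq_mul, measure_univ, mul_one]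
    exact ENNReal.one_le_ofReal.1 h1
  have hc0 : 0 < c := one_pos.trans_le hc
  by_cases hfin : klDiv P ρ = ∞
  · rw [hfin, top_add]; exact le_top
  rw [← ENNReal.ofReal_toReal hfin, ← ENNReal.ofReal_add ENNReal.toReal_nonneg (Real.log_nonneg hc)]
  refine Literature.Probability.Divergences.klDiv_le_of_forall_integral_le fun ψ C hψ hC => ?_
  have hexpi : ∀ (μ : Measure Ω) [IsFiniteMeasure μ], Integrable (fun x => Real.exp (ψ x)) μ := fun μ _ =>
    Integrable.of_bound hψ.exp.aestronglyMeasurable (Real.exp C) (ae_of_all _ fun x => by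
      rw [Real.norm_eq_abs, abs_of_pos (Real.exp_pos _)]
      exact Real.exp_le_exp.2 ((le_abs_self _).trans (hC x)))
  have hR : ∫ x, Real.exp (ψ x) ∂ρ ≤ c * ∫ x, Real.exp (ψ x) ∂ν := by
    calc ∫ x, Real.exp (ψ x) ∂ρ ≤ ∫ x, Real.exp (ψ x) ∂(ENNReal.ofReal c • ν) :=
          integral_mono_measure h (ae_of_all _ fun x => (Real.exp_pos _).le)
            ((hexpi ν).smul_measure ENNReal.ofReal_ne_top)
      _ = c * ∫ x, Real.exp (ψ x) ∂ν := by
          rw [integral_smul_measure, ENNReal.toReal_ofReal hc0.le, smul_eq_mul]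
  have hRpos : 0 < ∫ x, Real.exp (ψ x) ∂ρ := integral_exp_pos (hexpi ρ)
  have hνpos : 0 < ∫ x, Real.exp (ψ x) ∂ν := integral_exp_pos (hexpi ν)
  calc ∫ x, ψ x ∂P ≤ (klDiv P ρ).toReal + Real.log (∫ x, Real.exp (ψ x) ∂ρ) :=
        Literature.Probability.Divergences.integral_le_toReal_klDiv_add_log hfin hψ hC
    _ ≤ (klDiv P ρ).toReal + Real.log (c * ∫ x, Real.exp (ψ x) ∂ν) :=
        add_le_add le_rfl (Real.log_le_log hRpos hR)
    _ = (klDiv P ρ).toReal + Real.log c + Real.log (∫ x, Real.exp (ψ x) ∂ν) := by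
        rw [Real.log_mul hc0.ne' hνpos.ne', add_assoc]

/-! ## Locality: boundary conditions with an empty collar act like the empty one -/

/-- Nothing belongs to the empty configuration. -/
private theorem notMem_emptyConfig (p : V3 × V3) : p ∉ (∅ : PointConfig (V3 × V3)) := fun hp =>
  absurd (show p ∈ (∅ : PointConfig (V3 × V3)).carrier from hp) (by simp)

/-- Membership in a window restriction. -/
private theorem mem_windowRestrict_iff'' {Λ : Set V3} {ω : PointConfig (V3 × V3)} {p : V3 × V3} :
    p ∈ windowRestrict Λ ω ↔ p ∈ ω ∧ p.1 ∈ Λ :=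
  Iff.rfl

/-- The window `Λ` of a superposition in `Λ` does not see the boundary condition: it is the superposition with the
empty boundary condition (the thrown points with position in `Λ`). -/
theorem windowRestrict_superposeIn_eq_superposeIn_empty (Λ : Set V3) {k : ℕ} (x : Fin k → V3 × V3)
    (Y : PointConfig (V3 × V3)) : windowRestrict Λ (superposeIn Λ x Y) = superposeIn Λ x ∅ := by
  ext p
  rw [mem_windowRestrict_iff'', mem_superposeIn_iff, mem_superposeIn_iff]
  constructor
  · rintro ⟨hp | ⟨-, hpΛ⟩, hp'⟩
    · exact Or.inl hp
    · exact absurd hp' hpΛ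
  · rintro (hp | ⟨hp, -⟩)
    · exact ⟨Or.inl hp, hp.2⟩
    · exact absurd hp (notMem_emptyConfig p)

/-- The superposition with the empty boundary condition is contained in every superposition of the same points. -/
private theorem mem_superposeIn_of_mem_superposeIn_empty {Λ : Set V3} {k : ℕ} {x : Fin k → V3 × V3}
    {Y : PointConfig (V3 × V3)} {p : V3 × V3} (hp : p ∈ superposeIn Λ x ∅) : p ∈ superposeIn Λ x Y := by
  rcases (mem_superposeIn_iff Λ x ∅ p).1 hp with hp | ⟨hp, -⟩
  · exact (mem_superposeIn_iff Λ x Y p).2 (Or.inl hp)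
  · exact absurd hp (notMem_emptyConfig p)

/-- **The window hard core does not see a far boundary condition.** If every particle of `Y` with position outside `Λ`
is at distance `≥ ε` from `Λ`, the hard-core constraint in `Λ` of a superposition with `Y` holds iff it holds with the
empty boundary condition. -/
theorem hardCoreIn_superposeIn_iff_superposeIn_empty {ε : ℝ} {Λ : Set V3} {Y : PointConfig (V3 × V3)}
    (hY : ∀ p ∈ Y, p.1 ∉ Λ → ∀ a ∈ Λ, ε ≤ ‖a - p.1‖) {k : ℕ} (x : Fin k → V3 × V3) :
    HardCoreIn ε Λ (superposeIn Λ x Y) ↔ HardCoreIn ε Λ (superposeIn Λ x ∅) := by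
  refine ⟨hardCoreIn_anti fun p hp => mem_superposeIn_of_mem_superposeIn_empty hp, fun h p hp q hq hpq hΛ => ?_⟩
  rcases (mem_superposeIn_iff Λ x Y p).1 hp with hpx | ⟨hpY, hpΛ⟩
  · rcases (mem_superposeIn_iff Λ x Y q).1 hq with hqx | ⟨hqY, hqΛ⟩
    · exact h p ((mem_superposeIn_iff Λ x ∅ p).2 (Or.inl hpx)) q ((mem_superposeIn_iff Λ x ∅ q).2 (Or.inl hqx)) hpq hΛ
    · exact hY q hqY hqΛ p.1 hpx.2
  · rcases (mem_superposeIn_iff Λ x Y q).1 hq with hqx | ⟨-, hqΛ⟩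
    · rw [norm_sub_rev]
      exact hY p hpY hpΛ q.1 hqx.2
    · exact absurd hΛ (not_or.2 ⟨hpΛ, hqΛ⟩)

/-- Weights with pointwise equivalent integrands coincide. -/
private theorem gibbsWeight_congr_mem (ε z β : ℝ) (u : V3) (Λ : Set V3) {Y Y' : PointConfig (V3 × V3)}
    {B B' : Set (PointConfig (V3 × V3))}
    (h : ∀ (k : ℕ) (x : Fin k → V3 × V3),
      superposeIn Λ x Y ∈ B ∩ {X | HardCoreIn ε Λ X} ↔ superposeIn Λ x Y' ∈ B' ∩ {X | HardCoreIn ε Λ X}) :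
    gibbsWeight ε z β u Λ Y B = gibbsWeight ε z β u Λ Y' B' := by
  unfold Literature.Analysis.FluidPDE.gibbsWeight
  refine tsum_congr fun k => ?_
  congr 1
  refine lintegral_congr fun x => ?_
  by_cases hx : superposeIn Λ x Y ∈ B ∩ {X | HardCoreIn ε Λ X}
  · rw [indicator_of_mem hx, indicator_of_mem ((h k x).1 hx)]
    rfl
  · rw [indicator_of_notMem hx, indicator_of_notMem (mt (h k x).2 hx)]

/-- **Locality of the weight for far boundary conditions**: on a window event `{X | X_Λ ∈ A}` the weight with a far
boundary condition `Y` is the free weight of `A`. -/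
theorem gibbsWeight_window_eq_free_of_far (ε z β : ℝ) (u : V3) {Λ : Set V3} {Y : PointConfig (V3 × V3)}
    (hY : ∀ p ∈ Y, p.1 ∉ Λ → ∀ a ∈ Λ, ε ≤ ‖a - p.1‖) (A : Set (PointConfig (V3 × V3))) :
    gibbsWeight ε z β u Λ Y (windowRestrict Λ ⁻¹' A) = gibbsWeight ε z β u Λ ∅ A := by
  refine gibbsWeight_congr_mem ε z β u Λ fun k x => ?_
  simp only [mem_inter_iff, mem_preimage, mem_setOf_eq, windowRestrict_superposeIn_eq_superposeIn_empty Λ x Y,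
    hardCoreIn_superposeIn_iff_superposeIn_empty hY x]

/-- Locality of the normalising weight for far boundary conditions. -/
theorem gibbsWeight_univ_eq_free_of_far (ε z β : ℝ) (u : V3) {Λ : Set V3} {Y : PointConfig (V3 × V3)}
    (hY : ∀ p ∈ Y, p.1 ∉ Λ → ∀ a ∈ Λ, ε ≤ ‖a - p.1‖) :
    gibbsWeight ε z β u Λ Y univ = gibbsWeight ε z β u Λ ∅ univ := by
  refine gibbsWeight_congr_mem ε z β u Λ fun k x => ?_
  simp only [mem_inter_iff, mem_univ, true_and, mem_setOf_eq, hardCoreIn_superposeIn_iff_superposeIn_empty hY x]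

/-- **A boundary condition with no particle above the collar `(thickening ε Λ) \ Λ` is far from `Λ`**: each of its
particles with position outside `Λ` is at distance `≥ ε` from every position in `Λ`. -/
theorem far_of_count_collar_eq_zero {ε : ℝ} {Λ : Set V3} {Y : PointConfig (V3 × V3)}
    (hY : Y.count (Prod.fst ⁻¹' (Metric.thickening ε Λ \ Λ)) = 0) :
    ∀ p ∈ Y, p.1 ∉ Λ → ∀ a ∈ Λ, ε ≤ ‖a - p.1‖ := by
  intro p hp hpΛ a ha
  have hpT : p.1 ∉ Metric.thickening ε Λ := fun h =>
    (Set.eq_empty_iff_forall_notMem.1 (Set.encard_eq_zero.1 hY)) p ⟨hp, h, hpΛ⟩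
  rw [Metric.mem_thickening_iff] at hpT
  have h : ¬dist p.1 a < ε := fun hlt => hpT ⟨a, ha, hlt⟩
  rw [dist_eq_norm, norm_sub_rev, not_lt] at h
  exact h

/-- **The specification of a window event with a void collar is the free law**: if `Y` has no particle above
`(thickening ε Λ) \ Λ`, then `γ_Λ({X | X_Λ ∈ A} | Y) = γ_Λ(A | ∅)` (as the measure `gibbsSpecMeasure … Λ ∅`). -/
theorem gibbsSpec_window_eq_free_of_void (ε z β : ℝ) (u : V3) {Λ : Set V3} (hΛ : MeasurableSet Λ)
    {Y : PointConfig (V3 × V3)} (hY : Y.count (Prod.fst ⁻¹' (Metric.thickening ε Λ \ Λ)) = 0)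
    {A : Set (PointConfig (V3 × V3))} (hA : MeasurableSet A) :
    gibbsSpec ε z β u Λ Y (windowRestrict Λ ⁻¹' A) = gibbsSpecMeasure ε z β u Λ ∅ A := by
  rw [gibbsSpecMeasure_apply ε z β u hΛ ∅ hA]
  unfold Literature.Analysis.FluidPDE.gibbsSpec
  rw [gibbsWeight_window_eq_free_of_far ε z β u (far_of_count_collar_eq_zero hY) A,
    gibbsWeight_univ_eq_free_of_far ε z β u (far_of_count_collar_eq_zero hY)]

/-! ## The void probability of a bounded region under a Gibbs state -/

/-- **`weight(univ | Y) ≤ e^{z vol Λ}`** for `z ≥ 0`, `β > 0` and a window of finite volume: the hard-core indicator is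
`≤ 1` and the a-priori law has mass `vol Λ`. -/
theorem gibbsWeight_univ_le_ofReal_exp (ε : ℝ) {z β : ℝ} (hz : 0 ≤ z) (hβ : 0 < β) (u : V3) {Λ : Set V3}
    (hΛ : MeasurableSet Λ) (hΛv : volume Λ ≠ ∞) (Y : PointConfig (V3 × V3)) :
    gibbsWeight ε z β u Λ Y univ ≤ ENNReal.ofReal (Real.exp (z * (volume Λ).toReal)) := by
  haveI := sigmaFinite_maxwellPhaseMeasure β u Λ
  set r : ℝ := (volume Λ).toReal with hr
  have hle : ∀ k : ℕ, ENNReal.ofReal (z ^ k / (Nat.factorial k)) *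
      (Measure.pi fun _ : Fin k => maxwellPhaseMeasure β u Λ) {x | HardCoreIn ε Λ (superposeIn Λ x Y)} ≤
      ENNReal.ofReal ((z * r) ^ k / (Nat.factorial k)) := fun k => by
    calc ENNReal.ofReal (z ^ k / (Nat.factorial k)) *
          (Measure.pi fun _ : Fin k => maxwellPhaseMeasure β u Λ) {x | HardCoreIn ε Λ (superposeIn Λ x Y)}
        ≤ ENNReal.ofReal (z ^ k / (Nat.factorial k)) * (Measure.pi fun _ : Fin k => maxwellPhaseMeasure β u Λ) univ :=
          mul_le_mul' le_rfl (measure_mono (subset_univ _))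
      _ = ENNReal.ofReal (z ^ k / (Nat.factorial k)) * ENNReal.ofReal (r ^ k) := by
          rw [Measure.pi_univ, Finset.prod_const, Finset.card_univ, Fintype.card_fin, maxwellPhaseMeasure_univ hβ,
            hr, ENNReal.ofReal_pow ENNReal.toReal_nonneg, ENNReal.ofReal_toReal hΛv]
      _ = ENNReal.ofReal ((z * r) ^ k / (Nat.factorial k)) := by
          rw [← ENNReal.ofReal_mul (by positivity), mul_pow, div_mul_eq_mul_div]
  rw [gibbsWeight_univ_eq_tsum ε z β u hΛ Y]
  calc ∑' k : ℕ, ENNReal.ofReal (z ^ k / (Nat.factorial k)) *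
        (Measure.pi fun _ : Fin k => maxwellPhaseMeasure β u Λ) {x | HardCoreIn ε Λ (superposeIn Λ x Y)}
      ≤ ∑' k : ℕ, ENNReal.ofReal ((z * r) ^ k / (Nat.factorial k)) := ENNReal.tsum_le_tsum hle
    _ = ENNReal.ofReal (∑' k : ℕ, (z * r) ^ k / (Nat.factorial k)) :=
        (ENNReal.ofReal_tsum_of_nonneg (fun k => by positivity) (Real.summable_pow_div_factorial _)).symm
    _ = ENNReal.ofReal (Real.exp (z * r)) := by
        rw [Real.exp_eq_exp_ℝ, NormedSpace.exp_eq_tsum_div]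

/-- The void events `{X | N_{s}(X) = 0}` of measurable sets are measurable. -/
theorem measurableSet_count_eq_zero {s : Set (V3 × V3)} (hs : MeasurableSet s) :
    MeasurableSet {X : PointConfig (V3 × V3) | X.count s = 0} :=
  (PointConfig.measurable_count hs) (measurableSet_singleton (0 : ℕ∞))

/-- **`1 ≤ weight(void | Y)`**: with no particle thrown into `Λ` the superposition has no particle above `Λ` and is
hard-core compatible in `Λ`, so the `k = 0` term of the weight of the void event `{X | N_{Λ × ℝ³}(X) = 0}` is `1`. -/
theorem one_le_gibbsWeight_void (ε z β : ℝ) (u : V3) (Λ : Set V3) (Y : PointConfig (V3 × V3)) :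
    1 ≤ gibbsWeight ε z β u Λ Y {X | X.count (Prod.fst ⁻¹' Λ) = 0} := by
  haveI := sigmaFinite_maxwellPhaseMeasure β u Λ
  have hvoid : ∀ x : Fin 0 → V3 × V3,
      superposeIn Λ x Y ∈ {X : PointConfig (V3 × V3) | X.count (Prod.fst ⁻¹' Λ) = 0} ∩ {X | HardCoreIn ε Λ X} :=
    fun x => ⟨by
      rw [mem_setOf_eq, superposeIn_zero, PointConfig.count_restrict, ← preimage_inter, compl_inter_self, preimage_empty]
      simp [PointConfig.count], hardCoreIn_superposeIn_zero ε Λ x Y⟩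
  unfold Literature.Analysis.FluidPDE.gibbsWeight
  refine le_trans ?_ (ENNReal.le_tsum 0)
  have hind : ∀ x : Fin 0 → V3 × V3, ({X : PointConfig (V3 × V3) | X.count (Prod.fst ⁻¹' Λ) = 0} ∩
      {X | HardCoreIn ε Λ X}).indicator (1 : PointConfig (V3 × V3) → ℝ≥0∞) (superposeIn Λ x Y) = 1 := fun x =>
    indicator_of_mem (hvoid x) _
  simp_rw [hind]
  rw [lintegral_const, Measure.pi_univ, Finset.univ_eq_empty, Finset.prod_empty, pow_zero, Nat.factorial_zero,
    Nat.cast_one, div_one, ENNReal.ofReal_one, one_mul, mul_one]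

/-- **Void probabilities of a Gibbs state**: for a bounded measurable region `Λ`, activity `z ≥ 0` and `β > 0`,
`G{no particle above Λ} ≥ e^{-z vol Λ}` — the DLR equation in `Λ` with `γ_Λ(void | Y) ≥ 1 / e^{z vol Λ}` for EVERY
boundary condition `Y`. -/
theorem ofReal_exp_neg_le_measure_void {ε z β : ℝ} {u : V3} {G : Measure (PointConfig (V3 × V3))} (hz : 0 ≤ z)
    (hβ : 0 < β) (hG : IsHardSphereGibbs ε z β u G) {Λ : Set V3} (hΛ : MeasurableSet Λ) (hΛb : Bornology.IsBounded Λ) :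
    ENNReal.ofReal (Real.exp (-(z * (volume Λ).toReal))) ≤ G {X | X.count (Prod.fst ⁻¹' Λ) = 0} := by
  haveI := hG.1
  have hΛv : volume Λ ≠ ∞ := hΛb.measure_lt_top.ne
  have hVm : MeasurableSet {X : PointConfig (V3 × V3) | X.count (Prod.fst ⁻¹' Λ) = 0} :=
    measurableSet_count_eq_zero (hΛ.preimage measurable_fst)
  rw [hG.2 Λ hΛ hΛb _ hVm]
  calc ENNReal.ofReal (Real.exp (-(z * (volume Λ).toReal)))
      = ∫⁻ _, ENNReal.ofReal (Real.exp (-(z * (volume Λ).toReal))) ∂G := by rw [lintegral_const, measure_univ, mul_one]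
    _ ≤ ∫⁻ Y, gibbsSpec ε z β u Λ Y {X | X.count (Prod.fst ⁻¹' Λ) = 0} ∂G := lintegral_mono fun Y => by
        unfold Literature.Analysis.FluidPDE.gibbsSpec
        calc ENNReal.ofReal (Real.exp (-(z * (volume Λ).toReal)))
            = (ENNReal.ofReal (Real.exp (z * (volume Λ).toReal)))⁻¹ := by
              rw [Real.exp_neg, ENNReal.ofReal_inv_of_pos (Real.exp_pos _)]
          _ = 1 / ENNReal.ofReal (Real.exp (z * (volume Λ).toReal)) := (one_div _).symm
          _ ≤ gibbsWeight ε z β u Λ Y {X | X.count (Prod.fst ⁻¹' Λ) = 0} / gibbsWeight ε z β u Λ Y univ :=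
              ENNReal.div_le_div (one_le_gibbsWeight_void ε z β u Λ Y) (gibbsWeight_univ_le_ofReal_exp ε hz hβ u hΛ hΛv Y)

/-! ## The registered stubs -/

/-- Registered stub `c9_windowLaw_gibbs_ge_free` (line `FirstLemma`): **the window law of a Gibbs state dominates the
free finite-volume law up to the void cost of the collar**, `e^{-z vol((thickening 1 Λ) \ Λ)} γ_Λ(A | ∅) ≤ G_Λ(A)`.
DLR in `Λ` on the window event `{ω | ω_Λ ∈ A}`, restricted to the boundary conditions with no particle above the collar
(there the specification is the free one, `gibbsSpec_window_eq_free_of_void`), and the void bound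
`ofReal_exp_neg_le_measure_void` for the collar. -/
theorem c9_windowLaw_gibbs_ge_free {z β : ℝ} {u : V3} {G : Measure (PointConfig (V3 × V3))}
    (hz : 0 ≤ z) (hβ : 0 < β) (hG : IsHardSphereGibbs 1 z β u G) {Λ : Set V3} (hΛ : MeasurableSet Λ)
    (hΛb : Bornology.IsBounded Λ) {A : Set (PointConfig (V3 × V3))} (hA : MeasurableSet A) :
    ENNReal.ofReal (Real.exp (-(z * (volume (Metric.thickening 1 Λ \ Λ)).toReal))) *
        gibbsSpecMeasure 1 z β u Λ ∅ A ≤ windowLaw Λ G A := by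
  haveI := hG.1
  have hTm : MeasurableSet (Metric.thickening 1 Λ \ Λ) := Metric.isOpen_thickening.measurableSet.diff hΛ
  have hTb : Bornology.IsBounded (Metric.thickening 1 Λ \ Λ) := hΛb.thickening.subset fun _ hx => hx.1
  set V : Set (PointConfig (V3 × V3)) := {X | X.count (Prod.fst ⁻¹' (Metric.thickening 1 Λ \ Λ)) = 0} with hV
  have hVm : MeasurableSet V := measurableSet_count_eq_zero (hTm.preimage measurable_fst)
  have hBm : MeasurableSet (windowRestrict Λ ⁻¹' A) := measurable_windowRestrict hΛ hA
  rw [Literature.MathematicalPhysics.KineticTheory.PointProcess.windowLaw, Measure.map_apply (measurable_windowRestrict hΛ) hA,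
    hG.2 Λ hΛ hΛb _ hBm]
  calc ENNReal.ofReal (Real.exp (-(z * (volume (Metric.thickening 1 Λ \ Λ)).toReal))) * gibbsSpecMeasure 1 z β u Λ ∅ A
      ≤ G V * gibbsSpecMeasure 1 z β u Λ ∅ A := mul_le_mul' (ofReal_exp_neg_le_measure_void hz hβ hG hTm hTb) le_rfl
    _ = gibbsSpecMeasure 1 z β u Λ ∅ A * G V := mul_comm _ _
    _ = ∫⁻ Y, V.indicator (fun _ => gibbsSpecMeasure 1 z β u Λ ∅ A) Y ∂G := (lintegral_indicator_const hVm _).symm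
    _ ≤ ∫⁻ Y, gibbsSpec 1 z β u Λ Y (windowRestrict Λ ⁻¹' A) ∂G := lintegral_mono fun Y => by
        by_cases hY : Y ∈ V
        · rw [indicator_of_mem hY, gibbsSpec_window_eq_free_of_void 1 z β u hΛ hY hA]
        · rw [indicator_of_notMem hY]
          exact zero_le

/-- The free finite-volume law `γ_Λ(· | ∅)` of a window of finite volume is a probability measure (`z ≥ 0`, `β > 0`). -/
theorem isProbabilityMeasure_gibbsSpecMeasure_empty {z β : ℝ} (hz : 0 ≤ z) (hβ : 0 < β) (u : V3) {Λ : Set V3}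
    (hΛ : MeasurableSet Λ) (hΛv : volume Λ ≠ ∞) : IsProbabilityMeasure (gibbsSpecMeasure 1 z β u Λ ∅) :=
  isProbabilityMeasure_gibbsSpecMeasure 1 z β u hΛ
    ((gibbsWeight_univ_le_ofReal_exp 1 hz hβ u hΛ hΛv ∅).trans_lt ENNReal.ofReal_lt_top).ne

/-- Registered stub `c9_klDiv_windowLaw_gibbs_le_klDiv_free_add` (line `FirstLemma`): **the Gibbs reference swap**
`KL(P ‖ G_Λ) ≤ KL(P ‖ γ_Λ(· | ∅)) + z · vol((thickening 1 Λ) \ Λ)` for every probability law `P`, every DLR Gibbs state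
`G` of the unit-diameter hard-sphere gas and every bounded measurable window `Λ`: `γ_Λ(· | ∅) ≤ e^{z vol(collar)} G_Λ`
setwise (`c9_windowLaw_gibbs_ge_free`), then `klDiv_le_klDiv_add_ofReal_log_of_le_smul`. -/
theorem c9_klDiv_windowLaw_gibbs_le_klDiv_free_add {z β : ℝ} {u : V3} {G : Measure (PointConfig (V3 × V3))}
    (hz : 0 ≤ z) (hβ : 0 < β) (hG : IsHardSphereGibbs 1 z β u G) {Λ : Set V3} (hΛ : MeasurableSet Λ)
    (hΛb : Bornology.IsBounded Λ) (P : Measure (PointConfig (V3 × V3))) [IsProbabilityMeasure P] :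
    klDiv P (windowLaw Λ G) ≤
      klDiv P (gibbsSpecMeasure 1 z β u Λ ∅) + ENNReal.ofReal (z * (volume (Metric.thickening 1 Λ \ Λ)).toReal) := by
  haveI := hG.1
  haveI : IsProbabilityMeasure (windowLaw Λ G) := isProbabilityMeasure_windowLaw hΛ G
  haveI := isProbabilityMeasure_gibbsSpecMeasure_empty hz hβ u hΛ hΛb.measure_lt_top.ne
  set a : ℝ := z * (volume (Metric.thickening 1 Λ \ Λ)).toReal with ha
  have hdom : gibbsSpecMeasure 1 z β u Λ ∅ ≤ ENNReal.ofReal (Real.exp a) • windowLaw Λ G := by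
    refine Measure.le_iff.2 fun A hA => ?_
    rw [Measure.smul_apply, smul_eq_mul]
    calc gibbsSpecMeasure 1 z β u Λ ∅ A
        = ENNReal.ofReal (Real.exp a) * (ENNReal.ofReal (Real.exp (-a)) * gibbsSpecMeasure 1 z β u Λ ∅ A) := by
          rw [← mul_assoc, ← ENNReal.ofReal_mul (Real.exp_pos a).le, ← Real.exp_add, add_neg_cancel, Real.exp_zero,
            ENNReal.ofReal_one, one_mul]
      _ ≤ ENNReal.ofReal (Real.exp a) * windowLaw Λ G A :=
          mul_le_mul' le_rfl (c9_windowLaw_gibbs_ge_free hz hβ hG hΛ hΛb hA)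
  calc klDiv P (windowLaw Λ G) ≤ klDiv P (gibbsSpecMeasure 1 z β u Λ ∅) + ENNReal.ofReal (Real.log (Real.exp a)) :=
        klDiv_le_klDiv_add_ofReal_log_of_le_smul P _ _ hdom
    _ = klDiv P (gibbsSpecMeasure 1 z β u Λ ∅) + ENNReal.ofReal a := by rw [Real.log_exp]

end Summit.AtomisticToContinuum.HydrodynamicLimit.Theorems.KiferCompactification

end
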